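import Mathlib.Geometry.Manifold.ContMDiff.NormedSpace
import Mathlib.Geometry.Manifold.Algebra.Structures
import Mathlib.Analysis.SpecialFunctions.Complex.LogDeriv
import Mathlib.Analysis.SpecialFunctions.Complex.Arg
import Mathlib.Analysis.InnerProductSpace.Calculus
import Literature.Topology.FourManifolds.TorusCoordinates
import HarnessLib

/-!
# Correcting a unit framing function by a phase on a bump (gluing framings of a surface tube)

Topic `Literature/Topology/FourManifolds` (fact seat of the Seiberg–Witten leaf
`Literature.Barriers.SmoothPoincare4.akhmedovPark2010_lemma8_invariants`; block 2 of
Akhmedov–Park's `X₁(m)`, A. Akhmedov, B. D. Park, Invent. Math. 181 (2010), §3).  The tube of the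
genus-two surface `Σ̄₂ ⊂ T⁴ # ℂℙ²bar` is assembled from the product tubes of two tori, the neck of
a resolved double point (`DoublePointResolutionNeck.lean`: framing `conj û` at the neck circle of
each sheet) and the cap of a blown-up one (`BlowUpLineCapTube.lean`: framing `û`); in between, on
each twice-punctured torus, the product framing has to be re-phased by a smooth unit complex
function `φ` which EQUALS the prescribed framings on the two matching annuli (total winding
`-1 + 1 = 0`, so `φ` exists; Kirby, *The Topology of 4-Manifolds* (1989), Ch. IV p. 26: the
trivialisations of the normal bundle of a surface are acted on by maps to `S¹`).  This file proves
the elementary gluing step used to build such `φ` (no definitions, no named facts):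

* `contMDiffOn_arg_mul_conj` — **the relative phase of two unit functions is smooth where they
  are not opposite**: for smooth unit-complex `u`, `Φ` on an open set `V` of a manifold and a real
  constant `α` with `Re (u Φ̄ e^{-iα}) > 0` on `V`, the phase `ψ = arg (u Φ̄ e^{-iα})` is smooth on
  `V` and `u = Φ e^{iα} e^{iψ}` (the argument is real-analytic on the slit plane);
* `exists_unit_framing_correction` — **bump gluing**: if moreover `Φ` is a smooth unit function on
  an open `S ⊇ V` and `β` is a smooth real function whose topological support meets `S` inside `V`,
  then `φ = Φ exp(i β (α + ψ))` is a smooth unit function on `S` with `φ = u` where `β = 1` (in `V`)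
  and `φ = Φ` where `β = 0`.

## References

* R. C. Kirby, *The Topology of 4-Manifolds*, LNM 1374 (1989), Ch. IV (framings of surfaces,
  action of `[F, S¹]`). [Kirby1989]
* A. Akhmedov, B. D. Park, Invent. Math. 181 (2010) 577–603, §3. [AkhmedovPark2010]
-/

noncomputable section

open scoped Manifold ContDiff Topology ComplexConjugate
open Set Function Complex

namespace Literature.Topology.FourManifolds

namespace FramingCorrection

variable {E : Type*} [NormedAddCommGroup E] [NormedSpace ℝ E] {H : Type*} [TopologicalSpace H]
  {IM : ModelWithCorners ℝ E H} {M : Type*} [TopologicalSpace M] [ChartedSpace H M]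

/-- Products of real-smooth complex-valued functions on a manifold are real-smooth. [folklore] -/
theorem contMDiffOn_mul_complex {f g : M → ℂ} {s : Set M} (hf : ContMDiffOn IM 𝓘(ℝ, ℂ) ∞ f s)
    (hg : ContMDiffOn IM 𝓘(ℝ, ℂ) ∞ g s) : ContMDiffOn IM 𝓘(ℝ, ℂ) ∞ (fun x => f x * g x) s :=
  (contDiff_mul (𝕜 := ℝ) (𝔸 := ℂ)).contMDiff.comp_contMDiffOn (hf.prodMk_space hg)

/-- A product `u Φ̄ c` of unit complex numbers with positive real part lies in the slit plane and
has norm one. [folklore] -/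
theorem norm_mul_conj_mul_exp {u Φ : ℂ} (hu : ‖u‖ = 1) (hΦ : ‖Φ‖ = 1) (α : ℝ) :
    ‖u * conj Φ * Complex.exp (-(α * I))‖ = 1 := by
  rw [norm_mul, norm_mul, Complex.norm_conj, hu, hΦ, one_mul, one_mul,
    show -((α : ℂ) * I) = ((-α : ℝ) : ℂ) * I by push_cast; ring, Complex.norm_exp_ofReal_mul_I]

/-- **The relative phase of two unit functions is smooth where they are not opposite.**  For
`u, Φ : M → ℂ` smooth on an open set `V` with `‖u‖ = ‖Φ‖ = 1` and `Re (u Φ̄ e^{-iα}) > 0` on `V`,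
the phase `ψ x = arg (u x Φ̄ x e^{-iα})` is smooth on `V` and `u = Φ e^{iα} e^{iψ}` on `V`.
[folklore] -/
theorem contMDiffOn_arg_mul_conj {u Φ : M → ℂ} {V : Set M}
    (hu : ContMDiffOn IM 𝓘(ℝ, ℂ) ∞ u V) (hΦ : ContMDiffOn IM 𝓘(ℝ, ℂ) ∞ Φ V)
    (hu1 : ∀ x ∈ V, ‖u x‖ = 1) (hΦ1 : ∀ x ∈ V, ‖Φ x‖ = 1) (α : ℝ)
    (hre : ∀ x ∈ V, 0 < (u x * conj (Φ x) * Complex.exp (-(α * I))).re) :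
    ContMDiffOn IM 𝓘(ℝ, ℝ) ∞ (fun x => arg (u x * conj (Φ x) * Complex.exp (-(α * I)))) V ∧
    ∀ x ∈ V, u x = Φ x * Complex.exp (α * I) *
      Complex.exp ((arg (u x * conj (Φ x) * Complex.exp (-(α * I))) : ℝ) * I) := by
  have hprod : ContMDiffOn IM 𝓘(ℝ, ℂ) ∞ (fun x => u x * conj (Φ x) * Complex.exp (-(α * I))) V :=
    contMDiffOn_mul_complex (contMDiffOn_mul_complex hu
      (Complex.conjCLE.contDiff.contMDiff.comp_contMDiffOn hΦ)) contMDiffOn_const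
  refine ⟨fun x hx => ?_, fun x hx => ?_⟩
  · exact ((contDiffAt_arg (Or.inl (hre x hx))).contMDiffAt.contMDiffWithinAt).comp x (hprod x hx)
      (mapsTo_univ _ _)
  · set w : ℂ := u x * conj (Φ x) * Complex.exp (-(α * I)) with hw
    have hw1 : ‖w‖ = 1 := norm_mul_conj_mul_exp (hu1 x hx) (hΦ1 x hx) α
    have hexp : Complex.exp ((arg w : ℝ) * I) = w := by
      have := Complex.norm_mul_exp_arg_mul_I w
      rw [hw1, Complex.ofReal_one, one_mul] at this
      exact this
    rw [hexp, hw]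
    have hΦΦ : Φ x * conj (Φ x) = 1 := by
      rw [Complex.mul_conj, Complex.normSq_eq_norm_sq, hΦ1 x hx]; norm_num
    have he : Complex.exp (α * I) * Complex.exp (-(α * I)) = 1 := by
      rw [← Complex.exp_add, add_neg_cancel, Complex.exp_zero]
    calc u x = u x * (Φ x * conj (Φ x)) * (Complex.exp (α * I) * Complex.exp (-(α * I))) := by
          rw [hΦΦ, he, mul_one, mul_one]
      _ = Φ x * Complex.exp (α * I) * (u x * conj (Φ x) * Complex.exp (-(α * I))) := by ring

/-- **Bump gluing of unit framings.**  Let `Φ` be a smooth unit complex function on an open set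
`S` (not necessarily open), `u` a smooth unit complex function on an open `V ⊆ S` with `Re (u Φ̄ e^{-iα}) > 0` on `V`, and
`β : M → ℝ` smooth with `tsupport β ∩ S ⊆ V`.  Then `φ = Φ exp(i β (α + ψ))`, `ψ = arg (u Φ̄ e^{-iα})`
(junk off `V`, where `β` vanishes near every point of `S`), is a smooth unit complex function on `S`
which equals `u` on `{β = 1} ∩ V` and `Φ` on `{β = 0} ∩ S`. [cite: Kirby1989, Ch. IV] -/
theorem exists_unit_framing_correction {Φ u : M → ℂ} {S V : Set M} (hV : IsOpen V)
    (hVS : V ⊆ S) (hΦ : ContMDiffOn IM 𝓘(ℝ, ℂ) ∞ Φ S) (hu : ContMDiffOn IM 𝓘(ℝ, ℂ) ∞ u V)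
    (hΦ1 : ∀ x ∈ S, ‖Φ x‖ = 1) (hu1 : ∀ x ∈ V, ‖u x‖ = 1) (α : ℝ)
    (hre : ∀ x ∈ V, 0 < (u x * conj (Φ x) * Complex.exp (-(α * I))).re)
    {β : M → ℝ} (hβ : ContMDiff IM 𝓘(ℝ, ℝ) ∞ β) (hβV : ∀ x ∈ S, x ∈ tsupport β → x ∈ V) :
    ∃ φ : M → ℂ, ContMDiffOn IM 𝓘(ℝ, ℂ) ∞ φ S ∧ (∀ x ∈ S, ‖φ x‖ = 1) ∧
      (∀ x ∈ V, β x = 1 → φ x = u x) ∧ (∀ x ∈ S, β x = 0 → φ x = Φ x) ∧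
      (∀ x ∈ S, x ∉ tsupport β → φ x = Φ x) := by
  obtain ⟨hψ, hident⟩ := contMDiffOn_arg_mul_conj hu (hΦ.mono hVS) hu1
    (fun x hx => hΦ1 x (hVS hx)) α hre
  set ψ : M → ℝ := fun x => arg (u x * conj (Φ x) * Complex.exp (-(α * I))) with hψdef
  refine ⟨fun x => Φ x * Complex.exp (((β x * (α + ψ x) : ℝ) : ℂ) * I), ?_, ?_, ?_, ?_, ?_⟩
  · -- smoothness on `S`: near points of `V` by the formula, elsewhere `β = 0` near the point
    intro x hx
    by_cases hxV : x ∈ V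
    · have hloc : ContMDiffOn IM 𝓘(ℝ, ℂ) ∞
          (fun x => Φ x * Complex.exp (((β x * (α + ψ x) : ℝ) : ℂ) * I)) V := by
        have h1 : ContMDiffOn IM 𝓘(ℝ, ℝ) ∞ (fun x => β x * (α + ψ x)) V :=
          hβ.contMDiffOn.mul (contMDiffOn_const.add hψ)
        have h2 : ContMDiffOn IM 𝓘(ℝ, ℂ) ∞ (fun x => ((β x * (α + ψ x) : ℝ) : ℂ) * I) V :=
          contMDiffOn_mul_complex (Complex.ofRealCLM.contDiff.contMDiff.comp_contMDiffOn h1)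
            contMDiffOn_const
        exact contMDiffOn_mul_complex (hΦ.mono hVS)
          (((Complex.contDiff_exp : ContDiff ℂ ∞ Complex.exp).restrict_scalars ℝ).contMDiff.comp_contMDiffOn h2)
      exact (hloc x hxV).mono_of_mem_nhdsWithin (mem_nhdsWithin_of_mem_nhds (hV.mem_nhds hxV))
    · have hxt : x ∉ tsupport β := fun h => hxV (hβV x hx h)
      have hzero : ∀ᶠ y in 𝓝 x, β y = 0 := by
        have : (tsupport β)ᶜ ∈ 𝓝 x := (isClosed_tsupport β).isOpen_compl.mem_nhds hxt
        filter_upwards [this] with y hy using image_eq_zero_of_notMem_tsupport hy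
      have heq : (fun y => Φ y * Complex.exp (((β y * (α + ψ y) : ℝ) : ℂ) * I)) =ᶠ[𝓝[S] x] Φ := by
        refine mem_nhdsWithin_of_mem_nhds (hzero.mono fun y hy => ?_)
        show Φ y * Complex.exp (((β y * (α + ψ y) : ℝ) : ℂ) * I) = Φ y
        rw [hy, zero_mul, Complex.ofReal_zero, zero_mul, Complex.exp_zero, mul_one]
      exact (hΦ x hx).congr_of_eventuallyEq heq (by
        show Φ x * Complex.exp (((β x * (α + ψ x) : ℝ) : ℂ) * I) = Φ x
        rw [hzero.self_of_nhds, zero_mul, Complex.ofReal_zero, zero_mul, Complex.exp_zero, mul_one])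
  · intro x hx
    rw [norm_mul, hΦ1 x hx, Complex.norm_exp_ofReal_mul_I, mul_one]
  · intro x hx h1
    show Φ x * Complex.exp (((β x * (α + ψ x) : ℝ) : ℂ) * I) = u x
    rw [hident x hx, h1, one_mul, mul_assoc, ← Complex.exp_add]
    congr 1
    simp only [hψdef]
    push_cast
    ring
  · intro x _ h0
    show Φ x * Complex.exp (((β x * (α + ψ x) : ℝ) : ℂ) * I) = Φ x
    rw [h0, zero_mul, Complex.ofReal_zero, zero_mul, Complex.exp_zero, mul_one]
  · intro x _ hxt
    show Φ x * Complex.exp (((β x * (α + ψ x) : ℝ) : ℂ) * I) = Φ x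
    rw [image_eq_zero_of_notMem_tsupport hxt, zero_mul, Complex.ofReal_zero, zero_mul,
      Complex.exp_zero, mul_one]

/-! ### The model framing `unit (conj (z - p) (z - q))` on the twice-punctured plane -/

/-- `z ↦ unit (conj (z - p) (z - q))` is smooth off `{p, q}` (as a function on `ℂ`). [folklore] -/
theorem contDiffOn_unit_conj_sub_mul_sub (p q : ℂ) :
    ContDiffOn ℝ ∞ (fun z : ℂ =>
      ((‖conj (z - p) * (z - q)‖⁻¹ : ℝ) : ℂ) * (conj (z - p) * (z - q))) {z | z ≠ p ∧ z ≠ q} := by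
  intro z hz
  have hz' : conj (z - p) * (z - q) ≠ 0 :=
    mul_ne_zero ((map_ne_zero (starRingEnd ℂ)).2 (sub_ne_zero.2 hz.1)) (sub_ne_zero.2 hz.2)
  have hf : ContDiffAt ℝ ∞ (fun z : ℂ => conj (z - p) * (z - q)) z :=
    (Complex.conjCLE.contDiff.contDiffAt.comp z (contDiffAt_id.sub contDiffAt_const)).mul
      (contDiffAt_id.sub contDiffAt_const)
  have hn : ContDiffAt ℝ ∞ (fun z : ℂ => ‖conj (z - p) * (z - q)‖⁻¹) z :=
    ((contDiffAt_norm ℝ hz').comp z hf).inv (norm_ne_zero_iff.2 hz')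
  exact ((Complex.ofRealCLM.contDiff.contDiffAt.comp z hn).mul hf).contDiffWithinAt

/-- Far from both punctures the model framing is close to `1`: `Re (conj (z - p) (z - q)) > 0`
whenever `‖z‖ ≥ 2 (‖p‖ + ‖q‖)` and `z ≠ 0` (so it can be cut off to `1` near the boundary of a
large disc). [folklore] -/
theorem re_conj_sub_mul_sub_pos {p q z : ℂ} (hz : 2 * (‖p‖ + ‖q‖) ≤ ‖z‖) (hz0 : z ≠ 0) :
    0 < (conj (z - p) * (z - q)).re := by
  -- `conj (z - p) (z - q) = |z|² - z̄ q - p̄ z + p̄ q`, and the three corrections are small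
  have hzz : (conj z * z).re = ‖z‖ ^ 2 := by
    rw [mul_comm, Complex.mul_conj, Complex.normSq_eq_norm_sq]; norm_cast
  have h1 : |(conj z * q).re| ≤ ‖z‖ * ‖q‖ := by
    refine (Complex.abs_re_le_norm _).trans ?_
    rw [norm_mul, Complex.norm_conj]
  have h2 : |(conj p * z).re| ≤ ‖p‖ * ‖z‖ := by
    refine (Complex.abs_re_le_norm _).trans ?_
    rw [norm_mul, Complex.norm_conj]
  have h3 : |(conj p * q).re| ≤ ‖p‖ * ‖q‖ := by
    refine (Complex.abs_re_le_norm _).trans ?_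
    rw [norm_mul, Complex.norm_conj]
  have hexp : (conj (z - p) * (z - q)).re =
      (conj z * z).re - (conj z * q).re - (conj p * z).re + (conj p * q).re := by
    simp only [map_sub, sub_mul, mul_sub, Complex.sub_re]
    ring
  rw [hexp, hzz]
  have hzpos : 0 < ‖z‖ := norm_pos_iff.2 hz0
  have hp := norm_nonneg p
  have hq := norm_nonneg q
  have ha := abs_le.1 h1
  have hb := abs_le.1 h2
  have hc := abs_le.1 h3
  nlinarith

end FramingCorrection

end Literature.Topology.FourManifolds
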